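import Summits.HodgeConjecture.HodgeCM.Model.LiuDictionary
import Summits.HodgeConjecture.CorCM.D2Bridge.HcmPieces
import Literature.NumberTheory.Automorphic.Liu2021.AppendixC.Prop413DataOfTower
import HarnessLib

/-!
# Δ2 BRIDGE — S∞ WITH ITS RESIDUAL AS BINDERS: `LiuDictionary.Thm418C` from [Liu2021] Thm 4.18 AS PRINTED + the named pins

Cell pub-hodgecm2 (COR-CM), Δ2 BRIDGE; assembler seat planner-pub-hodgecm2-d2bridge-plan-g0-0 (bytes), filed by a d2bridge prover.
THREE theorems, no `def`, no named fact, HEAD LITERALLY `T.Thm418C` (`HodgeCM/Model/LiuDictionary.lean` :212, the r8 combined reading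
`hM_of_port` consumes as `h418`), for EVERY real-carrier dictionary `T : LiuDictionary hHD hI h₁ h₃ V` (in particular the pin
`liuDictionaryPin …`): `HodgeCM.Model.LiuDictionary.thm418C_of_asPrinted_resolved_small` = the module of record's pin-facing form
✔ `D2Bridge.thm418Combined_of_asPrinted_resolved_small` at `W K := H¹(P_K; ℂ)`, `res := T.res`, `cmCl := T.cmClasses` (ONE application;
the statement seat's compile-verified signature `HOME/d2bridge/Thm418CAtPinSignature.stmt-g2.lean`, same name and binders), and
`HodgeCM.Model.LiuDictionary.thm418C_of_asPrinted_resolved_of_decomposition_small` = the same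
(p366132, `CorCM/D2Bridge/HcmPieces.lean` v4) with `hmultD` DERIVED from a Prop-4.13-shaped decomposition of `T.H`
(✔ `D2Bridge.rank_intertwiningMap_le_one_of_decomposition`), and `…thm418C_of_asPrinted_of_prop413AsPrinted_small` = the same at rests
`U.rest (tail μ hμ hg)` over μ-uniform Weil carriers with the multiplicity pin DISCHARGED from the LITERAL cite
`h413 : Prop413AsPrinted (U.prop413Data T.H)` (L2.1 ✔ p366783 `UniformOmega.rank_intertwiningMap_rhoAt_rest_le_one_of_prop413AsPrinted`).  `Thm418C` unfolds to `T.Thm418Combined T.res T.cmClasses` by `rfl`.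

THE SURVIVING BINDERS ARE THE EXACT RESIDUAL OF THE Δ2 BRIDGE at this head (directive «(1)+(2) sorry-free OR exact residual»):
DATA `C ∕ R ∕ Good ∕ hbad ∕ Ks` · CITES AS PRINTED `hLiu` [Thm. 4.18], `σ413 ∕ Φ413 ∕ hΦ413` [Prop. 4.13 statement shape], `h411W ∕ hirrD`
[Def. 4.11], `hsepW` [Thm. 4.18 (2) ∕ Lem. D.1 (3)], `hnvD` [Lem. D.1 (1)] · X-PINS `σ ∕ hσ ∕ e ∕ he` (Ω: the dictionary's μ-pieces are
Liu's ω(μ,ε,χ) — at the normaliser δ′ per the referee's OBJECT-MATCH AUDIT), `M ∕ jH ∕ hjHinj ∕ hjH` (J: the proof's map (4.2)∕(4.3) read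
into `T.H`), `pieces` (S1–S4 below the threshold `Ks`, structure `HcmPieces`).  Each pin is discharged by its owner's file at
`T := liuDictionaryPin …`; nothing is discharged here.  This file imports the Model cone (`HodgeCM.Model.LiuDictionary`, manifest row —
imported, never edited) and is itself OUTSIDE the port manifest.
HC_CM is NOT proved; «Δ2 BRIDGE CLOSED» is NOT claimed; hLiu at the constructed objects is a READING (r8) until every pin is a theorem.

**Theorem 4 (DECISION #9, 2026-08-23 18:10Z)** `thm418C_of_asPrinted_of_prop413AsPrinted_perLine_small`: theorem 3 with PER-LINE uniform
families `U μ hμ hg : UniformOmega C` and [Prop. 4.13] cited literally once per good line — the form the pin composition uses (no Hasse-norm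
input; the Ω-pin transport is literal at every line of record).

## References
* [Liu2021] Y. Liu, *Fourier–Jacobi cycles and arithmetic relative trace formula*, Camb. J. Math. 9 (2021) = arXiv:2102.11518 —
  Thm. 4.18 (l. 2232–2245) with proof (l. 2247–2268), Thm. 4.18 (1), (2), Prop. 4.13 (l. 2113–2119), Def. 4.11, Lem. 2.4 (1),
  Def. 4.5 (2), App. D Lem. D.1 (1), (3).
* [Bump1997] D. Bump, *Automorphic forms and representations*, CUP 1997 — Prop. 4.2.4.

-/

set_option autoImplicit false

noncomputable section

open scoped TensorProduct DirectSum

namespace HodgeCM.Model.LiuDictionary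

open HodgeCM.Literature.Theta HodgeCM.Literature.Theta.LiuAlbaneseModuleDatum
open HodgeCM.Literature.Theta.LiuAlbaneseModuleDatum.D2Bridge
open Summit.HodgeConjecture.CorCM
open Literature.AlgebraicGeometry.ShimuraVarieties.UnitaryCanonicalModel
open Literature.NumberTheory.Automorphic.Liu2021 Literature.NumberTheory.Automorphic.Liu2021.AppendixC NumberField
open Literature.RepresentationTheory

universe v''

/-- **S∞ with its residual as binders — [Liu2021, Thm. 4.18] AS PRINTED + the named pins ⟹ `T.Thm418C`** for every real-carrier
dictionary `T` (the pin-facing App-C form of the module of record at `W K := H¹(P_K; ℂ)`, `res := T.res`, `cmCl := T.cmClasses`;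
multiplicity `hmultD` kept as a PIN binder — the statement seat's compile-verified S∞ signature `Thm418CAtPinSignature.stmt-g2.lean`,
same name, same binders).  The binders ARE the residual; see the module docstring.
[cite: Liu2021, Thm. 4.18 (l. 2232–2245) with proof l. 2247–2268, Thm. 4.18 (1), (2), Prop. 4.13 (l. 2113–2119), Def. 4.11, Lem. 2.4 (1), Def. 4.5 (2), App. D Lem. D.1 (1), (3)]
[cite: Bump1997, Proposition 4.2.4] -/
theorem thm418C_of_asPrinted_resolved_small
    {hHD : Literature.AlgebraicGeometry.HodgeTheory.exists_isReal_hodgeModel}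
    {hI : Literature.AlgebraicGeometry.HodgeTheory.hodgePQ_independent_of_hodgeModel}
    {h₁ : Literature.NumberTheory.Automorphic.PicardCM.BallQuotientUniformised}
    {h₃ : Literature.NumberTheory.Automorphic.PicardCM.CMAbelianVarietyRealised}
    {L : HodgeCM.CMField} {ι₁ : L →+* ℂ} (V : HodgeCM.HermSpace3 L ι₁)
    (h : exists_recordSystem) (Φ : Literature.AlgebraicGeometry.Motives.CMType L)
    {isotropicAt : ℕ → Prop}
    (C : Sec42Data (Model.honestP5Of h ⟨L.K⟩ ι₁ ⟨V.Hm, V.isHermitian, V.signature_ι₁, V.posDef_of_ne⟩ Φ) isotropicAt)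
    (T : HodgeCM.Model.LiuDictionary hHD hI h₁ h₃ V)
    (Good : T.Char → Prop) (hbad : ∀ μ : T.Char, T.PhiMu μ → ¬ Good μ → T.block μ = ⊥)
    (R : ∀ μ : T.Char, T.PhiMu μ → Good μ → Thm418Rest C)
    (hLiu : ∀ (μ : T.Char) (hμ : T.PhiMu μ) (hg : Good μ), Thm418AsPrinted (toThm418Data C (R μ hμ hg)))
    (σ : ∀ (μ : T.Char) (hμ : T.PhiMu μ) (hg : Good μ), T.Adm μ → (toThm418Data C (R μ hμ hg)).AdmIndex)
    (hσ : ∀ (μ : T.Char) (hμ : T.PhiMu μ) (hg : Good μ), Function.Injective (σ μ hμ hg))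
    (e : ∀ (μ : T.Char) (hμ : T.PhiMu μ) (hg : Good μ) (a : T.Adm μ),
      T.Ω μ a ≃ₗ[ℂ] (toThm418Data C (R μ hμ hg)).omegaAt (σ μ hμ hg a))
    (he : ∀ (μ : T.Char) (hμ : T.PhiMu μ) (hg : Good μ) (a : T.Adm μ) (g : ↥V.adelicFin) (m : T.Ω μ a),
      e μ hμ hg a (MonoidAlgebra.of ℂ ↥V.adelicFin g • m) = (toThm418Data C (R μ hμ hg)).rhoAt (σ μ hμ hg a) g (e μ hμ hg a m))
    (M : ∀ (μ : T.Char) (hμ : T.PhiMu μ) (hg : Good μ), (toThm418Data C (R μ hμ hg)).Map43RationalData)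
    (jH : ∀ (μ : T.Char) (hμ : T.PhiMu μ) (hg : Good μ), (M μ hμ hg).HB →ₗ[ℂ] T.H)
    (hjHinj : ∀ (μ : T.Char) (hμ : T.PhiMu μ) (hg : Good μ), Function.Injective (jH μ hμ hg))
    (hjH : ∀ (μ : T.Char) (hμ : T.PhiMu μ) (hg : Good μ) (g : ↥V.adelicFin) (x : (M μ hμ hg).HB),
      jH μ hμ hg ((M μ hμ hg).ρB g x) = MonoidAlgebra.of ℂ ↥V.adelicFin g • jH μ hμ hg x)
    -- ── X2 RESOLVED BELOW THE THRESHOLD ──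
    (Ks : T.Char → HodgeCM.Level V)
    (pieces : ∀ (μ : T.Char) (hμ : T.PhiMu μ) (hg : Good μ) (K : HodgeCM.Level V), K ≤ Ks μ →
      HcmPieces.{0, v'', 0} (toThm418Data C (R μ hμ hg)) (M μ hμ hg) T.H (jH μ hμ hg) K.K
        ((HodgeCM.Model.picardCMUniverse hHD hI h₁ h₃).CohC ((HodgeCM.Model.picardCMUniverse hHD hI h₁ h₃).pms L ι₁ V K) 1)
        (T.res K) (T.cmClasses K μ))
    -- ── [Lem D.1 (1)] and [Bump97 Prop 4.2.4 via Prop 4.13] at the rest, as PIN binders ──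
    (hnvD : ∀ (μ : T.Char) (hμ : T.PhiMu μ) (hg : Good μ) (i : (toThm418Data C (R μ hμ hg)).AdmIndex),
      Nontrivial ((toThm418Data C (R μ hμ hg)).omegaAt i))
    (hmultD : ∀ (μ : T.Char) (hμ : T.PhiMu μ) (hg : Good μ) (i : (toThm418Data C (R μ hμ hg)).AdmIndex),
      Module.rank ℂ (Representation.IntertwiningMap ((toThm418Data C (R μ hμ hg)).rhoAt i)
        (Representation.ofModule' (k := ℂ) (G := ↥V.adelicFin) T.H)) ≤ 1) :
    T.Thm418C :=
  -- `Thm418C` is `T.Thm418Combined T.res T.cmClasses` by definition (`LiuDictionary.lean` :212): ONE application of the module of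
  -- record's pin-facing form ✔ `thm418Combined_of_asPrinted_resolved_small` (v4) at `W K := H¹(P_K; ℂ)`, `res := T.res`, `cmCl := T.cmClasses`.
  thm418Combined_of_asPrinted_resolved_small V h Φ C T.toLiuAlbaneseModuleDatum T.res T.cmClasses Good hbad R hLiu σ hσ e he M jH
    hjHinj hjH Ks pieces hnvD hmultD

/-- **S∞ with its residual as binders, multiplicity DERIVED — [Liu2021, Thm. 4.18] AS PRINTED + the named pins ⟹ `T.Thm418C`** for every real-carrier
dictionary `T` (the pin-facing App-C form of the module of record at `W K := H¹(P_K; ℂ)`, `res := T.res`, `cmCl := T.cmClasses`;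
multiplicity DERIVED from the Prop-4.13-shaped decomposition).  The binders ARE the residual; see the module docstring.
[cite: Liu2021, Thm. 4.18 (l. 2232–2245) with proof l. 2247–2268, Thm. 4.18 (1), (2), Prop. 4.13 (l. 2113–2119), Def. 4.11, Lem. 2.4 (1), Def. 4.5 (2), App. D Lem. D.1 (1), (3)]
[cite: Bump1997, Proposition 4.2.4] -/
theorem thm418C_of_asPrinted_resolved_of_decomposition_small
    {hHD : Literature.AlgebraicGeometry.HodgeTheory.exists_isReal_hodgeModel}
    {hI : Literature.AlgebraicGeometry.HodgeTheory.hodgePQ_independent_of_hodgeModel}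
    {h₁ : Literature.NumberTheory.Automorphic.PicardCM.BallQuotientUniformised}
    {h₃ : Literature.NumberTheory.Automorphic.PicardCM.CMAbelianVarietyRealised}
    {L : HodgeCM.CMField} {ι₁ : L →+* ℂ} (V : HodgeCM.HermSpace3 L ι₁)
    (h : exists_recordSystem) (Φ : Literature.AlgebraicGeometry.Motives.CMType L)
    {isotropicAt : ℕ → Prop}
    (C : Sec42Data (Model.honestP5Of h ⟨L.K⟩ ι₁ ⟨V.Hm, V.isHermitian, V.signature_ι₁, V.posDef_of_ne⟩ Φ) isotropicAt)
    (T : HodgeCM.Model.LiuDictionary hHD hI h₁ h₃ V)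
    (Good : T.Char → Prop) (hbad : ∀ μ : T.Char, T.PhiMu μ → ¬ Good μ → T.block μ = ⊥)
    (R : ∀ μ : T.Char, T.PhiMu μ → Good μ → Thm418Rest C)
    (hLiu : ∀ (μ : T.Char) (hμ : T.PhiMu μ) (hg : Good μ), Thm418AsPrinted (toThm418Data C (R μ hμ hg)))
    (σ : ∀ (μ : T.Char) (hμ : T.PhiMu μ) (hg : Good μ), T.Adm μ → (toThm418Data C (R μ hμ hg)).AdmIndex)
    (hσ : ∀ (μ : T.Char) (hμ : T.PhiMu μ) (hg : Good μ), Function.Injective (σ μ hμ hg))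
    (e : ∀ (μ : T.Char) (hμ : T.PhiMu μ) (hg : Good μ) (a : T.Adm μ),
      T.Ω μ a ≃ₗ[ℂ] (toThm418Data C (R μ hμ hg)).omegaAt (σ μ hμ hg a))
    (he : ∀ (μ : T.Char) (hμ : T.PhiMu μ) (hg : Good μ) (a : T.Adm μ) (g : ↥V.adelicFin) (m : T.Ω μ a),
      e μ hμ hg a (MonoidAlgebra.of ℂ ↥V.adelicFin g • m) = (toThm418Data C (R μ hμ hg)).rhoAt (σ μ hμ hg a) g (e μ hμ hg a m))
    (M : ∀ (μ : T.Char) (hμ : T.PhiMu μ) (hg : Good μ), (toThm418Data C (R μ hμ hg)).Map43RationalData)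
    (jH : ∀ (μ : T.Char) (hμ : T.PhiMu μ) (hg : Good μ), (M μ hμ hg).HB →ₗ[ℂ] T.H)
    (hjHinj : ∀ (μ : T.Char) (hμ : T.PhiMu μ) (hg : Good μ), Function.Injective (jH μ hμ hg))
    (hjH : ∀ (μ : T.Char) (hμ : T.PhiMu μ) (hg : Good μ) (g : ↥V.adelicFin) (x : (M μ hμ hg).HB),
      jH μ hμ hg ((M μ hμ hg).ρB g x) = MonoidAlgebra.of ℂ ↥V.adelicFin g • jH μ hμ hg x)
    -- ── X2 RESOLVED BELOW THE THRESHOLD ──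
    (Ks : T.Char → HodgeCM.Level V)
    (pieces : ∀ (μ : T.Char) (hμ : T.PhiMu μ) (hg : Good μ) (K : HodgeCM.Level V), K ≤ Ks μ →
      HcmPieces.{0, v'', 0} (toThm418Data C (R μ hμ hg)) (M μ hμ hg) T.H (jH μ hμ hg) K.K
        ((HodgeCM.Model.picardCMUniverse hHD hI h₁ h₃).CohC ((HodgeCM.Model.picardCMUniverse hHD hI h₁ h₃).pms L ι₁ V K) 1)
        (T.res K) (T.cmClasses K μ))
    -- ── [Lem D.1 (1)] and [Def 4.11] at the rest ──
    (hnvD : ∀ (μ : T.Char) (hμ : T.PhiMu μ) (hg : Good μ) (i : (toThm418Data C (R μ hμ hg)).AdmIndex),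
      Nontrivial ((toThm418Data C (R μ hμ hg)).omegaAt i))
    (hirrD : ∀ (μ : T.Char) (hμ : T.PhiMu μ) (hg : Good μ) (i : (toThm418Data C (R μ hμ hg)).AdmIndex),
      IsIrreducibleOrZero ((toThm418Data C (R μ hμ hg)).rhoAt i))
    -- ── [Prop 4.13]'s STATEMENT shape at the tower ──
    {ι413 : Type} {W413 : ι413 → Type} [∀ t, AddCommGroup (W413 t)] [∀ t, Module ℂ (W413 t)]
    (σ413 : ∀ t : ι413, Representation ℂ ↥V.adelicFin (W413 t))
    (Φ413 : T.H ≃ₗ[ℂ] ⨁ t, W413 t)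
    (hΦ413 : ∀ (g : ↥V.adelicFin) (x : T.H) (t : ι413),
      Φ413 (Representation.ofModule' (k := ℂ) (G := ↥V.adelicFin) T.H g x) t = σ413 t g (Φ413 x t))
    (h411W : ∀ t : ι413, IsIrreducibleOrZero (σ413 t) ∧ IsSmoothRep (σ413 t) ∧ IsAdmissibleRep (σ413 t))
    (hsepW : ∀ s t : ι413, Nontrivial (W413 s) →
      (∃ f : W413 s ≃ₗ[ℂ] W413 t, ∀ (g : ↥V.adelicFin) (v : W413 s), f (σ413 s g v) = σ413 t g (f v)) → s = t) :
    T.Thm418C :=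
  -- `Thm418C` is `T.Thm418Combined T.res T.cmClasses` by definition (`LiuDictionary.lean` :212); the pin-facing App-C form of the
  -- resolved increment (✔ `thm418Combined_of_asPrinted_resolved_small`, v4) at `W K := H¹(P_K; ℂ)`, `res := T.res`,
  -- `cmCl := T.cmClasses`, with the multiplicity pin DERIVED from the Prop-4.13-shaped decomposition (✔ `rank_intertwiningMap_le_one_of_decomposition`).
  thm418Combined_of_asPrinted_resolved_small V h Φ C T.toLiuAlbaneseModuleDatum T.res T.cmClasses Good hbad R hLiu σ hσ e he M jH
    hjHinj hjH Ks pieces hnvD fun μ hμ hg i =>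
      haveI := hnvD μ hμ hg i
      rank_intertwiningMap_le_one_of_decomposition V (Hc := T.H) ((toThm418Data C (R μ hμ hg)).rhoAt i)
        (hirrD μ hμ hg i) σ413 Φ413 hΦ413 h411W hsepW

/-- **S∞ with its residual as binders, [Prop 4.13] cited LITERALLY — [Liu2021, Thm. 4.18] AS PRINTED + the named pins ⟹ `T.Thm418C`** for every real-carrier
dictionary `T` (the pin-facing App-C form of the module of record at `W K := H¹(P_K; ℂ)`, `res := T.res`, `cmCl := T.cmClasses`;
the rests assembled from μ-UNIFORM Weil carriers `U : UniformOmega C` and tails, so that the multiplicity pin is DISCHARGED from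
`h413 : Prop413AsPrinted (U.prop413Data T.H)` — [Liu2021, Prop. 4.13] AS PRINTED with `H¹_{B,τ'}(A_∞,ℂ)` read as `T.H` — by L2.1's pay-off
✔ `UniformOmega.rank_intertwiningMap_rhoAt_rest_le_one_of_prop413AsPrinted` (p366783); `h411` [Def. 4.11], `hsep` [Lem. D.1 (3)], `hK`).  The binders ARE the residual; see the module docstring.
[cite: Liu2021, Thm. 4.18 (l. 2232–2245) with proof l. 2247–2268, Thm. 4.18 (1), (2), Prop. 4.13 (l. 2113–2119), Def. 4.11, Lem. 2.4 (1), Def. 4.5 (2), App. D Lem. D.1 (1), (3)]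
[cite: Bump1997, Proposition 4.2.4] -/
theorem thm418C_of_asPrinted_of_prop413AsPrinted_small
    {hHD : Literature.AlgebraicGeometry.HodgeTheory.exists_isReal_hodgeModel}
    {hI : Literature.AlgebraicGeometry.HodgeTheory.hodgePQ_independent_of_hodgeModel}
    {h₁ : Literature.NumberTheory.Automorphic.PicardCM.BallQuotientUniformised}
    {h₃ : Literature.NumberTheory.Automorphic.PicardCM.CMAbelianVarietyRealised}
    {L : HodgeCM.CMField} {ι₁ : L →+* ℂ} (V : HodgeCM.HermSpace3 L ι₁)
    (h : exists_recordSystem) (Φ : Literature.AlgebraicGeometry.Motives.CMType L)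
    {isotropicAt : ℕ → Prop}
    (C : Sec42Data (Model.honestP5Of h ⟨L.K⟩ ι₁ ⟨V.Hm, V.isHermitian, V.signature_ι₁, V.posDef_of_ne⟩ Φ) isotropicAt)
    (T : HodgeCM.Model.LiuDictionary hHD hI h₁ h₃ V)
    (Good : T.Char → Prop) (hbad : ∀ μ : T.Char, T.PhiMu μ → ¬ Good μ → T.block μ = ⊥)
    -- ── the rests: μ-UNIFORM Weil carriers `U` (so that [Prop 4.13] is citable LITERALLY over `U.prop413Data T.H`) + a tail per good line;
    --    `R₀` only supplies each line's Hecke character and its conjugate-symplecticity (at the pin: the model's `restOfCharD …`) ──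
    (U : UniformOmega C) (R₀ : ∀ μ : T.Char, T.PhiMu μ → Good μ → Thm418Rest C)
    (tail : ∀ (μ : T.Char) (hμ : T.PhiMu μ) (hg : Good μ), RestTail C (R₀ μ hμ hg).μ (R₀ μ hμ hg).isConjugateSymplectic)
    (hLiu : ∀ (μ : T.Char) (hμ : T.PhiMu μ) (hg : Good μ), Thm418AsPrinted (toThm418Data C (U.rest (tail μ hμ hg))))
    (σ : ∀ (μ : T.Char) (hμ : T.PhiMu μ) (hg : Good μ), T.Adm μ → (toThm418Data C (U.rest (tail μ hμ hg))).AdmIndex)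
    (hσ : ∀ (μ : T.Char) (hμ : T.PhiMu μ) (hg : Good μ), Function.Injective (σ μ hμ hg))
    (e : ∀ (μ : T.Char) (hμ : T.PhiMu μ) (hg : Good μ) (a : T.Adm μ),
      T.Ω μ a ≃ₗ[ℂ] (toThm418Data C (U.rest (tail μ hμ hg))).omegaAt (σ μ hμ hg a))
    (he : ∀ (μ : T.Char) (hμ : T.PhiMu μ) (hg : Good μ) (a : T.Adm μ) (g : ↥V.adelicFin) (m : T.Ω μ a),
      e μ hμ hg a (MonoidAlgebra.of ℂ ↥V.adelicFin g • m) = (toThm418Data C (U.rest (tail μ hμ hg))).rhoAt (σ μ hμ hg a) g (e μ hμ hg a m))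
    (M : ∀ (μ : T.Char) (hμ : T.PhiMu μ) (hg : Good μ), (toThm418Data C (U.rest (tail μ hμ hg))).Map43RationalData)
    (jH : ∀ (μ : T.Char) (hμ : T.PhiMu μ) (hg : Good μ), (M μ hμ hg).HB →ₗ[ℂ] T.H)
    (hjHinj : ∀ (μ : T.Char) (hμ : T.PhiMu μ) (hg : Good μ), Function.Injective (jH μ hμ hg))
    (hjH : ∀ (μ : T.Char) (hμ : T.PhiMu μ) (hg : Good μ) (g : ↥V.adelicFin) (x : (M μ hμ hg).HB),
      jH μ hμ hg ((M μ hμ hg).ρB g x) = MonoidAlgebra.of ℂ ↥V.adelicFin g • jH μ hμ hg x)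
    -- ── X2 RESOLVED BELOW THE THRESHOLD ──
    (Ks : T.Char → HodgeCM.Level V)
    (pieces : ∀ (μ : T.Char) (hμ : T.PhiMu μ) (hg : Good μ) (K : HodgeCM.Level V), K ≤ Ks μ →
      HcmPieces.{0, v'', 0} (toThm418Data C (U.rest (tail μ hμ hg))) (M μ hμ hg) T.H (jH μ hμ hg) K.K
        ((HodgeCM.Model.picardCMUniverse hHD hI h₁ h₃).CohC ((HodgeCM.Model.picardCMUniverse hHD hI h₁ h₃).pms L ι₁ V K) 1)
        (T.res K) (T.cmClasses K μ))
    -- ── [Lem D.1 (1)] at the rests (PIN binder) ──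
    (hnvD : ∀ (μ : T.Char) (hμ : T.PhiMu μ) (hg : Good μ) (i : (toThm418Data C (U.rest (tail μ hμ hg))).AdmIndex),
      Nontrivial ((toThm418Data C (U.rest (tail μ hμ hg))).omegaAt i))
    -- ── [Prop 4.13] AS PRINTED, cited LITERALLY over the uniform carriers with `H¹_{B,τ'}(A_∞,ℂ)` READ AS the tower `T.H`
    --    (✔ `UniformOmega.prop413Data`, L2.1 p366783), + [Def 4.11] and [Lem D.1 (3)] in its hypotheses' printed shape ──
    (h413 : Prop413AsPrinted (U.prop413Data T.H))
    (h411 : ∀ t : (U.prop413Data T.H).AdmTriple, IsIrreducibleOrZero ((U.prop413Data T.H).rhoAt t) ∧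
      IsSmoothRep ((U.prop413Data T.H).rhoAt t) ∧ IsAdmissibleRep ((U.prop413Data T.H).rhoAt t))
    (hsep : ∀ s t : (U.prop413Data T.H).AdmTriple, Nontrivial ((U.prop413Data T.H).omegaAt s) →
      (∃ f : (U.prop413Data T.H).omegaAt s ≃ₗ[ℂ] (U.prop413Data T.H).omegaAt t,
        ∀ (g : ↥V.adelicFin) (v : (U.prop413Data T.H).omegaAt s),
          f ((U.prop413Data T.H).rhoAt s g v) = (U.prop413Data T.H).rhoAt t g (f v)) → s = t)
    (hK : ∃ K : Subgroup ↥V.adelicFin, IsOpenCompact K) :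
    T.Thm418C :=
  -- theorem 1 at the rests `U.rest (tail μ hμ hg)`, with `hmultD` = L2.1's PAY-OFF ✔ `UniformOmega.rank_intertwiningMap_rhoAt_rest_le_one_of_prop413AsPrinted`
  -- from the LITERAL `h413` (`3 ≤ n` is `le_rfl` at `honestP5Of`, `n := 3`; `τ' := ι₁`).
  thm418C_of_asPrinted_resolved_small V h Φ C T Good hbad (fun μ hμ hg => U.rest (tail μ hμ hg)) hLiu σ hσ e he M jH hjHinj hjH
    Ks pieces hnvD fun μ hμ hg i =>
      U.rank_intertwiningMap_rhoAt_rest_le_one_of_prop413AsPrinted T.H h413 le_rfl ι₁ h411 hsep hK (tail μ hμ hg) i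


/-- **S∞, PER-LINE UNIFORM FAMILIES (DECISION #9)** — theorem 3 with the μ-uniform Weil carriers allowed to depend on the good line:
`U μ hμ hg : UniformOmega C` (value at the pin: `uniformOmegaRep … (2δ_L)⁻¹ (fun _ _ => repOfLine a_μ)`, the representative section THROUGH
the line of record, so that the Ω-pin transport is literal at every line and NO Hasse-norm input is needed to make one section serve all lines),
and [Liu2021, Prop. 4.13] cited LITERALLY once per good line: `h413 μ hμ hg : Prop413AsPrinted ((U μ hμ hg).prop413Data T.H)` — the SAME printed
proposition (it fixes arbitrary representatives `u` of the Gram classes), instantiated at the section through the line; `h411` ∕ `hsep` likewise.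
Theorem 3 is the constant family `fun _ _ _ => U`.
[cite: Liu2021, Thm. 4.18 (l. 2232–2245) with proof l. 2247–2268, Thm. 4.18 (1), (2), Prop. 4.13 (l. 2113–2119), Def. 4.11, Lem. 2.4 (1), Def. 4.5 (2), App. D Lem. D.1 (1), (3)]
[cite: Bump1997, Proposition 4.2.4] -/
theorem thm418C_of_asPrinted_of_prop413AsPrinted_perLine_small
    {hHD : Literature.AlgebraicGeometry.HodgeTheory.exists_isReal_hodgeModel}
    {hI : Literature.AlgebraicGeometry.HodgeTheory.hodgePQ_independent_of_hodgeModel}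
    {h₁ : Literature.NumberTheory.Automorphic.PicardCM.BallQuotientUniformised}
    {h₃ : Literature.NumberTheory.Automorphic.PicardCM.CMAbelianVarietyRealised}
    {L : HodgeCM.CMField} {ι₁ : L →+* ℂ} (V : HodgeCM.HermSpace3 L ι₁)
    (h : exists_recordSystem) (Φ : Literature.AlgebraicGeometry.Motives.CMType L)
    {isotropicAt : ℕ → Prop}
    (C : Sec42Data (Model.honestP5Of h ⟨L.K⟩ ι₁ ⟨V.Hm, V.isHermitian, V.signature_ι₁, V.posDef_of_ne⟩ Φ) isotropicAt)
    (T : HodgeCM.Model.LiuDictionary hHD hI h₁ h₃ V)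
    (Good : T.Char → Prop) (hbad : ∀ μ : T.Char, T.PhiMu μ → ¬ Good μ → T.block μ = ⊥)
    -- ── the rests: μ-UNIFORM Weil carriers `U` (so that [Prop 4.13] is citable LITERALLY, once per good line, over `(U μ hμ hg).prop413Data T.H`) + a tail per good line;
    --    `R₀` only supplies each line's Hecke character and its conjugate-symplecticity (at the pin: the model's `restOfCharD …`) ──
    (U : ∀ μ : T.Char, T.PhiMu μ → Good μ → UniformOmega C) (R₀ : ∀ μ : T.Char, T.PhiMu μ → Good μ → Thm418Rest C)
    (tail : ∀ (μ : T.Char) (hμ : T.PhiMu μ) (hg : Good μ), RestTail C (R₀ μ hμ hg).μ (R₀ μ hμ hg).isConjugateSymplectic)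
    (hLiu : ∀ (μ : T.Char) (hμ : T.PhiMu μ) (hg : Good μ), Thm418AsPrinted (toThm418Data C ((U μ hμ hg).rest (tail μ hμ hg))))
    (σ : ∀ (μ : T.Char) (hμ : T.PhiMu μ) (hg : Good μ), T.Adm μ → (toThm418Data C ((U μ hμ hg).rest (tail μ hμ hg))).AdmIndex)
    (hσ : ∀ (μ : T.Char) (hμ : T.PhiMu μ) (hg : Good μ), Function.Injective (σ μ hμ hg))
    (e : ∀ (μ : T.Char) (hμ : T.PhiMu μ) (hg : Good μ) (a : T.Adm μ),
      T.Ω μ a ≃ₗ[ℂ] (toThm418Data C ((U μ hμ hg).rest (tail μ hμ hg))).omegaAt (σ μ hμ hg a))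
    (he : ∀ (μ : T.Char) (hμ : T.PhiMu μ) (hg : Good μ) (a : T.Adm μ) (g : ↥V.adelicFin) (m : T.Ω μ a),
      e μ hμ hg a (MonoidAlgebra.of ℂ ↥V.adelicFin g • m) = (toThm418Data C ((U μ hμ hg).rest (tail μ hμ hg))).rhoAt (σ μ hμ hg a) g (e μ hμ hg a m))
    (M : ∀ (μ : T.Char) (hμ : T.PhiMu μ) (hg : Good μ), (toThm418Data C ((U μ hμ hg).rest (tail μ hμ hg))).Map43RationalData)
    (jH : ∀ (μ : T.Char) (hμ : T.PhiMu μ) (hg : Good μ), (M μ hμ hg).HB →ₗ[ℂ] T.H)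
    (hjHinj : ∀ (μ : T.Char) (hμ : T.PhiMu μ) (hg : Good μ), Function.Injective (jH μ hμ hg))
    (hjH : ∀ (μ : T.Char) (hμ : T.PhiMu μ) (hg : Good μ) (g : ↥V.adelicFin) (x : (M μ hμ hg).HB),
      jH μ hμ hg ((M μ hμ hg).ρB g x) = MonoidAlgebra.of ℂ ↥V.adelicFin g • jH μ hμ hg x)
    -- ── X2 RESOLVED BELOW THE THRESHOLD ──
    (Ks : T.Char → HodgeCM.Level V)
    (pieces : ∀ (μ : T.Char) (hμ : T.PhiMu μ) (hg : Good μ) (K : HodgeCM.Level V), K ≤ Ks μ →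
      HcmPieces.{0, v'', 0} (toThm418Data C ((U μ hμ hg).rest (tail μ hμ hg))) (M μ hμ hg) T.H (jH μ hμ hg) K.K
        ((HodgeCM.Model.picardCMUniverse hHD hI h₁ h₃).CohC ((HodgeCM.Model.picardCMUniverse hHD hI h₁ h₃).pms L ι₁ V K) 1)
        (T.res K) (T.cmClasses K μ))
    -- ── [Lem D.1 (1)] at the rests (PIN binder) ──
    (hnvD : ∀ (μ : T.Char) (hμ : T.PhiMu μ) (hg : Good μ) (i : (toThm418Data C ((U μ hμ hg).rest (tail μ hμ hg))).AdmIndex),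
      Nontrivial ((toThm418Data C ((U μ hμ hg).rest (tail μ hμ hg))).omegaAt i))
    -- ── [Prop 4.13] AS PRINTED, cited LITERALLY over the uniform carriers with `H¹_{B,τ'}(A_∞,ℂ)` READ AS the tower `T.H`
    --    (✔ `UniformOmega.prop413Data`, L2.1 p366783), + [Def 4.11] and [Lem D.1 (3)] in its hypotheses' printed shape ──
    (h413 : ∀ (μ : T.Char) (hμ : T.PhiMu μ) (hg : Good μ), Prop413AsPrinted ((U μ hμ hg).prop413Data T.H))
    (h411 : ∀ (μ : T.Char) (hμ : T.PhiMu μ) (hg : Good μ) (t : ((U μ hμ hg).prop413Data T.H).AdmTriple), IsIrreducibleOrZero (((U μ hμ hg).prop413Data T.H).rhoAt t) ∧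
      IsSmoothRep (((U μ hμ hg).prop413Data T.H).rhoAt t) ∧ IsAdmissibleRep (((U μ hμ hg).prop413Data T.H).rhoAt t))
    (hsep : ∀ (μ : T.Char) (hμ : T.PhiMu μ) (hg : Good μ) (s t : ((U μ hμ hg).prop413Data T.H).AdmTriple), Nontrivial (((U μ hμ hg).prop413Data T.H).omegaAt s) →
      (∃ f : ((U μ hμ hg).prop413Data T.H).omegaAt s ≃ₗ[ℂ] ((U μ hμ hg).prop413Data T.H).omegaAt t,
        ∀ (g : ↥V.adelicFin) (v : ((U μ hμ hg).prop413Data T.H).omegaAt s),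
          f (((U μ hμ hg).prop413Data T.H).rhoAt s g v) = ((U μ hμ hg).prop413Data T.H).rhoAt t g (f v)) → s = t)
    (hK : ∃ K : Subgroup ↥V.adelicFin, IsOpenCompact K) :
    T.Thm418C :=
  -- theorem 1 at the rests `(U μ hμ hg).rest (tail μ hμ hg)`, with `hmultD` = L2.1's PAY-OFF ✔ `UniformOmega.rank_intertwiningMap_rhoAt_rest_le_one_of_prop413AsPrinted`
  -- from the LITERAL `h413` (`3 ≤ n` is `le_rfl` at `honestP5Of`, `n := 3`; `τ' := ι₁`).
  thm418C_of_asPrinted_resolved_small V h Φ C T Good hbad (fun μ hμ hg => (U μ hμ hg).rest (tail μ hμ hg)) hLiu σ hσ e he M jH hjHinj hjH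
    Ks pieces hnvD fun μ hμ hg i =>
      (U μ hμ hg).rank_intertwiningMap_rhoAt_rest_le_one_of_prop413AsPrinted T.H (h413 μ hμ hg) le_rfl ι₁ (h411 μ hμ hg) (hsep μ hμ hg) hK (tail μ hμ hg) i
end HodgeCM.Model.LiuDictionary

end
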